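import Literature.MathematicalPhysics.KineticTheory.PseudoTrajectoryComparisonData
import HarnessLib

/-!
# Comparison of the main terms of the pruned BBGKY and Boltzmann expansions for the tagged sphere
# (BGSR Props. 5.3, 5.6, 5.7 assembled; toward Prop. 5.8)
(Bodineau–Gallagher–Saint-Raymond, Invent. Math. 203 (2016) = arXiv:1305.3397v2, §5.3.3–5.3.4,
Propositions 5.6, 5.7, 5.8, pp. 20–21 of the held text; trunk T-KINETIC, topic
MathematicalPhysics/KineticTheory; the ASSEMBLY of the comparison step of the bottom-up plan
towards the named fact `bgsr_linearBoltzmannApprox` (`TaggedSphereDiffusion`) recorded in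
`TaggedSphereLinearBoltzmannRate`: the abstract comparison `HierarchyComparison` instantiated with
the coupling `bgsrCouplingUpTo` (`PseudoTrajectoryComparisonStep`: BGSR Props. 5.1/5.3 and the
one-step comparison `relStep_bgsrCouplingUpTo`) and the data of `PseudoTrajectoryComparisonData`
(Prop. 5.7, second bullet).)

BGSR Proposition 5.8 (p. 21) gathers Props. 5.4–5.7 into
`‖f_N^{(1,K)} - g_α^{(1,K)}‖_∞ ≤ A^{K(K+1)}(Cαt)^{A^{K+1}} (e^{-βE²/4} + A^{2(K+1)}δ/t) ‖ρ⁰‖_∞ +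
A^{(K+2)(K+1)}(Cαt)^{A^{K+1}} (5.22) ‖ρ⁰‖_∞ + A^{K(K+1)}(Cαt)^{A^{K+1}} (A^{2(K+1)}/N + εα) ‖ρ⁰‖_∞`
before tuning `δ, ε₀, E, ā`. This file PROVES the two comparison ingredients of that display for
the tree's objects, at every regular one-particle configuration:

* `abs_sepBlockComp_hs_sub_boltzmann_le` — **the main terms of the two truncated, separated
  expansions are close** (Props. 5.3 + 5.6 + 5.7): for `N + 1` spheres of diameter `ε`
  (`α = (N+1)ε^{d-1}`, `N(2ε)^d ≤ 1/2`), thresholds `n_b = A^{b+1}`, `K ≥ 1` blocks of step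
  `h ≥ δ > 0`, energy cut-off `E`, bad-set parameters `ā, ε₀` of Prop. 5.1 with
  `(L_K + 1)ε ≤ ā`, `4ā ≤ ε₀`, `L_K = pruneLevel A K ≤ N + 1`, a bound `m_bad` on the measure of
  the bad sets, and a one-particle configuration `z` regular to all depths (`bgsrRegular`,
  `PseudoTrajectoryCoupling`),
  `|(sepBlockComp δ K [1_{H≤E²/2} f_N^0])^{(1)}(z) - (sepBlockComp δ K [1_{H≤E²/2} g_α(0)])^{(1)}(z)|
   ≤ C₀ (2R(N+1)(2ε)^d + 6 R' A^K (L_K ε^{d-1}/α + 4 E m_bad)) exp((6 c_R + 12α) C₀ h A^K)`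
  (`C₀ = max 1 (4(β/2π)^{d/2})`, `R' = max R 1`, `c_R` the pruning constant of the Boltzmann
  model) — the data discrepancy (Prop. 3.3: `C αε`), the prefactor discrepancy (`J_K²/N`-type:
  `L_K ε^{d-1}/α = L_K/(N+1)`) and the bad sets ((5.22)), each paid at most `n_b` times per block,
  times the block factors of the continuity estimates;
* `ae_abs_sepBlockComp_marginals_sub_initialMarginals_le` — **exchanging the BBGKY data** (the
  time-`0` marginal family of `HardSphereHierarchyModel`, which carries `1_{good}` inside the
  marginal) **for the honest initial marginals costs only the separation error**, almost
  everywhere, under the hypothesis (R) of the BBGKY side (`HierarchyModel.RespectsAE`): the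
  difference of the two data is a.e. zero, so its plain block composite vanishes a.e.
  (`blockComp_congr_ae`) and its separated composite is bounded by N5d₃'s
  `abs_blockComp_sub_sepBlockComp_le_of_budget`.

The final assembly with Props. 4.3, 5.4, 5.5 of both sides and the tuning of Prop. 5.8 are NOT
here.

## References

* T. Bodineau, I. Gallagher, L. Saint-Raymond, *The Brownian motion as the limit of a
  deterministic system of hard-spheres*, Invent. Math. 203 (2016) 493–553 = arXiv:1305.3397v2,
  §5.3.3–5.3.4 Props. 5.6–5.8, pp. 20–21.
-/

open MeasureTheory Metric Real Set Filter Function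
open scoped InnerProductSpace ENNReal Nat
open Literature.Analysis.FluidPDE (Config configEnergy Geometry GCState hardSphereDomain freeFlight
  bgsrGoodConfigs)

namespace Literature.MathematicalPhysics.KineticTheory

noncomputable section

open Literature.Analysis.FunctionSpaces.Torus Literature.Analysis.FluidPDE.Torus

section Kinetic

variable {d : Type*} [Fintype d] [DecidableEq d]

attribute [local instance] sigmaFinite_volume_phaseSpace

/-! ## Arithmetic of the thresholds -/

omit [DecidableEq d] in
/-- `∑_{b<K} A^{b+1} ≤ 6 A^K` (`A ≥ 2`; from `sum_pow_mul_sqrt_two_pow_le`, `√2^{K-b} ≥ 1`). [folklore] -/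
theorem sum_pow_succ_le_six {A : ℕ} (hA : 2 ≤ A) (K : ℕ) :
    ∑ b ∈ Finset.range K, (A : ℝ) ^ (b + 1) ≤ 6 * (A : ℝ) ^ K := by
  refine le_trans (Finset.sum_le_sum fun b _ => ?_) (sum_pow_mul_sqrt_two_pow_le hA K)
  have h1 : (1 : ℝ) ≤ sqrt 2 ^ (K - b) := one_le_pow₀ Real.one_lt_sqrt_two.le
  have h0 : 0 ≤ (A : ℝ) ^ (b + 1) := by positivity
  nlinarith

omit [DecidableEq d] in
/-- `∑_{b<K} L_{b+1} ≤ 12 A^K` for the levels `L_b = pruneLevel A b` (`L_{b+1} ≤ 2A^{b+1}`). [folklore] -/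
theorem sum_pruneLevel_succ_le {A : ℕ} (hA : 2 ≤ A) (K : ℕ) :
    ∑ b ∈ Finset.range K, ((pruneLevel A (b + 1) : ℕ) : ℝ) ≤ 12 * (A : ℝ) ^ K := by
  calc ∑ b ∈ Finset.range K, ((pruneLevel A (b + 1) : ℕ) : ℝ)
      ≤ ∑ b ∈ Finset.range K, 2 * (A : ℝ) ^ (b + 1) := Finset.sum_le_sum fun b _ => by
          have := pruneLevel_succ_le hA b
          exact_mod_cast this
    _ = 2 * ∑ b ∈ Finset.range K, (A : ℝ) ^ (b + 1) := by rw [Finset.mul_sum]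
    _ ≤ 2 * (6 * (A : ℝ) ^ K) := by gcongr; exact sum_pow_succ_le_six hA K
    _ = 12 * (A : ℝ) ^ K := by ring


omit [DecidableEq d] in
/-- Chaining four estimates: `|a - e| ≤ |a - b| + |b - c| + |c - d| + |d' - e|`-type bookkeeping in
the shape the assembly produces (`b - c`, `c - d`, `e - d`). [folklore] -/
theorem abs_sub_le_of_four {a b c d' e B₁ B₂ B₃ B₄ : ℝ} (h₁ : |a - b| ≤ B₁) (h₂ : |b - c| ≤ B₂)
    (h₃ : |c - d'| ≤ B₃) (h₄ : |e - d'| ≤ B₄) : |a - e| ≤ B₁ + B₂ + B₃ + B₄ := by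
  have h4' : |d' - e| ≤ B₄ := by rwa [abs_sub_comm]
  calc |a - e| = |(a - b) + (b - c) + (c - d') + (d' - e)| := by ring_nf
    _ ≤ |a - b| + |b - c| + |c - d'| + |d' - e| := by
        refine (abs_add_le _ _).trans (add_le_add ((abs_add_le _ _).trans (add_le_add (abs_add_le _ _) le_rfl)) le_rfl)
    _ ≤ B₁ + B₂ + B₃ + B₄ := by linarith

/-! ## The trivial one-step comparison (no coupling used) -/

omit [DecidableEq d] in
/-- **The trivial one-step comparison**: for the coupling `bgsrCouplingUpTo`, `RelStep` holds at
every particle number with `Λ_rel = 0` and `E_rel` the sum of the chain costs of the two models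
(each collision operator bounded separately by (4.11), `abs_transport_op_le`; the two
configurations of a coupled pair have the same kinetic energy). It serves the blocks beyond the
`K` that are actually composed, where the geometric hypotheses of `relStep_bgsrCouplingUpTo` need
not hold. [cite: BodineauGallagherSaintRaymondInvent2016, §4.2 (4.11), p. 12] -/
theorem relStep_bgsrCouplingUpTo_trivial {ε : ℝ} (hε : 0 < ε) (hε' : ε < 2⁻¹) (N : ℕ) (α ε₀ t : ℝ)
    {δ : ℝ} (hδ : 0 ≤ δ) (Ec : ℝ) {bm η : ℝ} (hbm : 0 < bm) (hη : 0 < η) (kmax : ℕ) :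
    (bgsrCouplingUpTo (d := d) hε hε' N α ε₀ hδ t).RelStep Ec bm η kmax 0
      ((hsHierarchyModel (d := d) hε hε' N).chainCost bm η kmax +
        (boltzmannModel (Literature.Analysis.FluidPDE.Torus.geometry d) measurable_translate_torus α).chainCost
          bm η kmax) := by
  set M₁ := hsHierarchyModel (d := d) hε hε' N with hM₁
  set M₂ := boltzmannModel (Literature.Analysis.FluidPDE.Torus.geometry d) measurable_translate_torus α with hM₂
  intro k hk σ p hp
  rw [mem_bgsrCouplingUpTo_rel] at hp
  obtain ⟨-, -, -, -, hready⟩ := hp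
  refine Eventually.of_forall fun s hsI g₁ g₂ K ηr b₀ hb₀ hK _ _ _ hg₁ hg₂ _ _ _ => ?_
  obtain ⟨hvel, -⟩ := hready s hsI
  -- the two configurations have the same energy, before and after transport
  have hH : configEnergy p.1 = configEnergy p.2 := by
    have h := configEnergy_eq_of_vel_eq hvel
    rwa [Literature.Analysis.FluidPDE.Alexander.configEnergy_regFlow,
      Literature.Analysis.FluidPDE.configEnergy_freeFlight] at h
  have h₁ := M₁.abs_transport_op_le hbm hη hk hb₀ hK hg₁ s p.1
  have h₂ := M₂.abs_transport_op_le hbm hη hk hb₀ hK hg₂ s p.2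
  rw [M₁.transport_apply, hH] at h₁
  rw [M₂.transport_apply] at h₂
  rw [M₂.configEnergy_flow]
  calc |M₁.op k g₁ (M₁.flow k (-s) p.1) - M₂.op k g₂ (M₂.flow k (-s) p.2)|
      ≤ |M₁.op k g₁ (M₁.flow k (-s) p.1)| + |M₂.op k g₂ (M₂.flow k (-s) p.2)| := abs_sub _ _
    _ ≤ M₁.chainCost bm η kmax * K * exp (-b₀ * configEnergy p.2) +
        M₂.chainCost bm η kmax * K * exp (-b₀ * configEnergy p.2) := add_le_add h₁ h₂
    _ = (0 * ηr + (M₁.chainCost bm η kmax + M₂.chainCost bm η kmax) * K) * exp (-b₀ * configEnergy p.2) := by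
        ring

/-! ## The main terms of the two expansions are close -/

section MainTerms

variable {ε : ℝ} (hε : 0 < ε) (hε' : ε < 2⁻¹) (N : ℕ) {β : ℝ} (hβ : 0 < β) {ρ₀ : UnitAddTorus d → ℝ}
  {R : ℝ} (hρ₀c : Continuous ρ₀) (hρ₀0 : ∀ x, 0 ≤ ρ₀ x) (hR : ∀ x, ρ₀ x ≤ R)
  (hN : (N : ℝ) * (2 * ε) ^ Fintype.card d ≤ 2⁻¹) {α : ℝ}
  (hαN : α = (N + 1 : ℝ) * ε ^ (Fintype.card d - 1))

include hβ hρ₀c hρ₀0 hR hN hαN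

/-- **BGSR Props. 5.3 + 5.6 + 5.7: the main terms of the truncated, separated BBGKY and Boltzmann
expansions are close.** Setting: `N + 1` hard spheres of diameter `ε` on `T^d` (`0 < ε < 1/2`,
`N(2ε)^d ≤ 1/2`) with BGSR's datum (`0 ≤ ρ⁰ ≤ R` continuous, `β > 0`), the Boltzmann hierarchy
with rate `α = (N+1)ε^{d-1}`, thresholds `n_b = A^{b+1}` (`A ≥ 2`), `K ≥ 1` blocks of step
`h ≥ δ > 0`, energy cut-off `E ≥ 0`, bad-set parameters `ā, ε₀` with `(L_K+1)ε ≤ ā`, `4ā ≤ ε₀`,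
`L_K = pruneLevel A K ≤ N + 1`, a bound `m_bad` on the `σ ⊗ dv`-measure of the bad sets
`bgsrBadSet (Kh) ā ε₀ δ (3E) Y m ∩ {|v| ≤ E}` at good `Y` of `≤ L_K` particles, and a one-particle
configuration `z` regular to all depths for the horizon `Kh`. Then, with the honest initial
marginals `f_N^0 = bgsrInitialMarginals` and `g_α(0) = ρ⁰ ⊗ M_β^{⊗s}`,
`|(sepBlockComp δ K [1_{H≤E²/2} f_N^0])^{(1)}(z) - (sepBlockComp δ K [1_{H≤E²/2} g_α(0)])^{(1)}(z)|
 ≤ C₀ (2R(N+1)(2ε)^d + 6 R' A^K (L_K ε^{d-1}/α + 4 E m_bad)) exp((6 c_R + 12 α) C₀ h A^K)`,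
`C₀ = max 1 (4(β/2π)^{d/2})`, `R' = max R 1`, `c_R = pruneConst` of the Boltzmann model
(`HierarchyComparison.abs_sepBlockComp_sub_sepBlockComp_le` with the coupling
`bgsrCouplingUpTo`, the one-step comparison `relStep_bgsrCouplingUpTo` below `K` and the trivial one
beyond, the data bounds of `PseudoTrajectoryComparisonData`, the budgets `(β/4)2^{-(K-b)}` of
Prop. 4.3 and the block factors of N4b; printed: Props. 5.6–5.7 summed,
`A^{K(K+1)}(Cαt)^{A^{K+1}} [A^{2(K+1)} (5.22) + A^{2(K+1)}/N + αε] ‖ρ⁰‖_∞`).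
[cite: BodineauGallagherSaintRaymondInvent2016, §5.3.3 Props. 5.6-5.7, pp. 20–21] -/
theorem abs_sepBlockComp_hs_sub_boltzmann_le {A : ℕ} (hA : 2 ≤ A) {K : ℕ} (hK : 1 ≤ K) {h δ : ℝ}
    (hδ : 0 < δ) (hh : δ ≤ h) {E : ℝ} (hE : 0 ≤ E) {ā ε₀ : ℝ} (hāε₀ : 4 * ā ≤ ε₀)
    (hLε : (pruneLevel A K + 1 : ℝ) * ε ≤ ā) (hLN : pruneLevel A K ≤ N + 1) {mBad : ℝ} (hmBad0 : 0 ≤ mBad)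
    (hmBad : ∀ k ≤ pruneLevel A K, ∀ (Y : Config k d (UnitAddTorus d)) (m : Fin k) (σ' : ℝ), 0 ≤ σ' →
      Y ∈ bgsrGoodConfigs (Literature.Analysis.FluidPDE.Torus.geometry d) k ε₀ σ' →
      ((sphereMeasure (E := EuclideanSpace ℝ d)).prod (volume : Measure (EuclideanSpace ℝ d)))
          {q : sphere (0 : EuclideanSpace ℝ d) 1 × EuclideanSpace ℝ d |
            ‖q.2‖ ≤ E ∧ ((q.1 : EuclideanSpace ℝ d), q.2) ∈ bgsrBadSet (K * h) ā ε₀ δ (3 * E) Y m} ≤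
        ENNReal.ofReal mBad)
    {z : Config 1 d (UnitAddTorus d)} (hreg : ∀ n, bgsrRegular ε n 1 (K * h) z) :
    |(hsHierarchyModel (d := d) hε hε' (N + 1)).sepBlockComp δ (pruneSeq A) h K
          (energyTruncate E (bgsrInitialMarginals hε hε' N β ρ₀)) 1 z -
        (boltzmannModel (Literature.Analysis.FluidPDE.Torus.geometry d) measurable_translate_torus α).sepBlockComp
          δ (pruneSeq A) h K
          (energyTruncate E fun a Z => bgsrHierarchyFamily β
            (linearBoltzmannSeries (Literature.Analysis.FluidPDE.Torus.geometry d) β α fun x _ => ρ₀ x) a 0 Z) 1 z| ≤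
      max 1 (4 * maxwellianConst d β) *
        (2 * R * (N + 1) * (2 * ε) ^ Fintype.card d +
          6 * max R 1 * (A : ℝ) ^ K * (pruneLevel A K * ε ^ (Fintype.card d - 1) / α + 4 * E * mBad)) *
        exp ((6 * (boltzmannModel (Literature.Analysis.FluidPDE.Torus.geometry d) measurable_translate_torus α).pruneConst β +
          12 * α) * max 1 (4 * maxwellianConst d β) * h * (A : ℝ) ^ K) := by
  haveI := Literature.Analysis.FluidPDE.isFiniteMeasure_sphereMeasure (E := EuclideanSpace ℝ d)
  -- names
  set M₁ := hsHierarchyModel (d := d) hε hε' (N + 1) with hM₁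
  set M₂ := boltzmannModel (Literature.Analysis.FluidPDE.Torus.geometry d) measurable_translate_torus α with hM₂
  set 𝒞 := bgsrCouplingUpTo (d := d) hε hε' (N + 1) α ε₀ hδ.le (K * h) with h𝒞
  set C₀ : ℝ := max 1 (4 * maxwellianConst d β) with hC₀
  set R' : ℝ := max R 1 with hR'
  set L : ℕ := pruneLevel A K with hL
  set pf : ℝ := L * ε ^ (Fintype.card d - 1) with hpf
  set θ : ℝ := pf / α + 4 * E * mBad with hθ
  set Cd : ℝ := (∫ u : EuclideanSpace ℝ d, (1 + ‖u‖) * exp (-(1 / 2) * ‖u‖ ^ 2)) *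
    (sphereMeasure (E := EuclideanSpace ℝ d)).real univ with hCd
  set βs : ℕ → ℝ := fun b => β / 4 / 2 ^ (K - b) with hβs
  set Sh : ℕ → ℝ := fun b => (sqrt (β / 2) ^ Fintype.card d)⁻¹ *
    (pruneLevel A (b + 1) * (sqrt (β / 2))⁻¹ + sqrt (pruneLevel A (b + 1) / (βs b / pruneSeq A b))) with hSh
  set Λs : ℕ → ℝ := fun b => M₂.chainCost (β / 2) (βs b / pruneSeq A b) (pruneLevel A (b + 1)) +
    α * pruneLevel A (b + 1) with hΛs
  set Λrels : ℕ → ℝ := fun b => if b < K then α * Cd * Sh b else 0 with hΛrels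
  set Erels : ℕ → ℝ := fun b => if b < K then pf * Cd * Sh b + 4 * α * pruneLevel A (b + 1) * E * mBad
    else M₁.chainCost (β / 2) (βs b / pruneSeq A b) (pruneLevel A (b + 1)) +
      M₂.chainCost (β / 2) (βs b / pruneSeq A b) (pruneLevel A (b + 1)) with hErels
  set θs : ℕ → ℝ := fun b => if b < K then θ else 2 with hθs
  -- elementary facts
  have hA1 : 1 ≤ A := by omega
  have hR0 : 0 ≤ R := (hρ₀0 0).trans (hR 0)
  have hR'0 : 0 ≤ R' := le_max_of_le_right zero_le_one
  have hRR' : R ≤ R' := le_max_left _ _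
  have hmc : 0 < maxwellianConst d β := maxwellianConst_pos hβ
  have hC₀1 : 1 ≤ C₀ := le_max_left _ _
  have hC₀0 : 0 ≤ C₀ := zero_le_one.trans hC₀1
  have hα0 : 0 < α := by rw [hαN]; positivity
  have hCd0 : 0 ≤ Cd := mul_nonneg (integral_nonneg fun u => by positivity) measureReal_nonneg
  have hpf0 : 0 ≤ pf := by have := hε.le; positivity
  have hθ0 : 0 ≤ θ := by positivity
  have hh0 : 0 ≤ h := hδ.le.trans hh
  have hβs0 : ∀ b, 0 < βs b := fun b => by positivity
  have hsb : 0 < sqrt (β / 2) := sqrt_pos.2 (half_pos hβ)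
  have hSh0 : ∀ b, 0 ≤ Sh b := fun b => by positivity
  have hmono : Monotone (pruneLevel A) := monotone_nat_of_le_succ (pruneLevel_le_succ hA1)
  -- the constants of the two models agree
  have hopc : M₁.opConst = M₂.opConst := by
    show (((N + 1 : ℕ) : ℝ) * ε ^ (Fintype.card d - 1)) * Cd = |α| * Cd
    rw [hαN, abs_of_nonneg (by have := hε.le; positivity)]
    push_cast; ring
  have hcc : ∀ (bm η' : ℝ) (k' : ℕ), M₁.chainCost bm η' k' = M₂.chainCost bm η' k' := fun bm η' k' => by
    simp only [HierarchyModel.chainCost, hopc]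
  have hc2 : ∀ b, M₂.chainCost (β / 2) (βs b / pruneSeq A b) (pruneLevel A (b + 1)) = α * Cd * Sh b := fun b => by
    show |α| * Cd * (sqrt (β / 2) ^ Fintype.card d)⁻¹ *
        (pruneLevel A (b + 1) * (sqrt (β / 2))⁻¹ + sqrt (pruneLevel A (b + 1) / (βs b / pruneSeq A b))) =
      α * Cd * Sh b
    rw [abs_of_nonneg hα0.le, hSh]; ring
  have hcnn : ∀ b, 0 ≤ M₂.chainCost (β / 2) (βs b / pruneSeq A b) (pruneLevel A (b + 1)) := fun b =>
    M₂.chainCost_nonneg _ _ _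
  have hΛs0 : ∀ b, 0 ≤ Λs b := fun b => by
    have := hcnn b; rw [hΛs]; positivity
  -- the hypotheses of the abstract comparison
  have hθs0 : ∀ b, 0 ≤ θs b := fun b => by
    rw [hθs]; dsimp only; split_ifs
    · exact hθ0
    · norm_num
  have hΛ₂ : ∀ b, M₂.chainCost (β / 2) (βs b / pruneSeq A b) (pruneLevel A (b + 1)) ≤ Λs b := fun b => by
    rw [hΛs]; dsimp only
    have : 0 ≤ α * pruneLevel A (b + 1) := by positivity
    linarith
  have hΛ₁ : ∀ b, M₁.chainCost (β / 2) (βs b / pruneSeq A b) (pruneLevel A (b + 1)) ≤ Λs b := fun b => by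
    rw [hcc]; exact hΛ₂ b
  have hΛr : ∀ b, Λrels b ≤ Λs b := fun b => by
    rw [hΛrels]; dsimp only; split_ifs
    · rw [← hc2]; exact hΛ₂ b
    · exact hΛs0 b
  have hEθ : ∀ b, Erels b ≤ θs b * Λs b := fun b => by
    rw [hErels, hθs]; dsimp only; split_ifs with hb
    · rw [hΛs, hθ]; dsimp only; rw [hc2]
      have h1 : pf * Cd * Sh b + 4 * α * ↑(pruneLevel A (b + 1)) * E * mBad ≤
          (pf / α + 4 * E * mBad) * (α * Cd * Sh b + α * ↑(pruneLevel A (b + 1))) := by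
        have e1 : (pf / α + 4 * E * mBad) * (α * Cd * Sh b + α * ↑(pruneLevel A (b + 1))) =
            pf * Cd * Sh b + 4 * α * ↑(pruneLevel A (b + 1)) * E * mBad +
              (pf * ↑(pruneLevel A (b + 1)) + 4 * E * mBad * (α * Cd * Sh b)) := by
          field_simp; ring
        rw [e1]
        have : 0 ≤ pf * ↑(pruneLevel A (b + 1)) + 4 * E * mBad * (α * Cd * Sh b) := by
          have := hSh0 b; positivity
        linarith
      exact h1
    · rw [hcc, hΛs]; dsimp only
      have := hcnn b
      have : 0 ≤ α * (pruneLevel A (b + 1) : ℝ) := by positivity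
      linarith
  have hV₁ : ∀ (k : ℕ) (g : Config (k + 1) d (UnitAddTorus d) → ℝ), (∀ Z, E ^ 2 / 2 < configEnergy Z → g Z = 0) →
      ∀ Z, E ^ 2 / 2 < configEnergy Z → M₁.op k g Z = 0 := fun k g hg Z hZ => by
    rw [hM₁, hsHierarchyModel_op]
    exact outBbgkyOp_eq_zero_of_lt' _ ε (N + 1) hg hZ
  have hV₂ : ∀ (k : ℕ) (g : Config (k + 1) d (UnitAddTorus d) → ℝ), (∀ Z, E ^ 2 / 2 < configEnergy Z → g Z = 0) →
      ∀ Z, E ^ 2 / 2 < configEnergy Z → M₂.op k g Z = 0 := fun k g hg Z hZ => by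
    rw [hM₂, boltzmannModel_op, boltzmannHOp_eq_zero_of_lt _ hg hZ, mul_zero]
  -- the one-step comparison, block by block
  have hstep : ∀ b, 𝒞.RelStep (E ^ 2 / 2) (β / 2) (βs b / pruneSeq A b) (pruneLevel A (b + 1)) (Λrels b) (Erels b) := by
    intro b
    have hηb : 0 < βs b / pruneSeq A b := div_pos (hβs0 b) (by exact_mod_cast one_le_pruneSeq hA1 b)
    by_cases hb : b < K
    · have hLb : pruneLevel A (b + 1) ≤ L := hmono (Nat.succ_le_of_lt hb)
      have hLb' : (pruneLevel A (b + 1) : ℝ) ≤ L := by exact_mod_cast hLb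
      have hkε : (pruneLevel A (b + 1) + 1 : ℝ) * ε ≤ ā :=
        le_trans (mul_le_mul_of_nonneg_right (by linarith) hε.le) hLε
      have hpfb : ∀ k ≤ pruneLevel A (b + 1), |((N + 1 - k : ℕ) : ℝ) * ε ^ (Fintype.card d - 1) - α| ≤ pf := by
        intro k hk
        have hkN : k ≤ N + 1 := hk.trans (hLb.trans hLN)
        have hkL : (k : ℝ) ≤ L := by exact_mod_cast hk.trans hLb
        rw [Nat.cast_sub hkN, hαN, hpf]
        push_cast
        rw [show ((N : ℝ) + 1 - k) * ε ^ (Fintype.card d - 1) - (N + 1) * ε ^ (Fintype.card d - 1) =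
          -(k * ε ^ (Fintype.card d - 1)) by ring, abs_neg, abs_of_nonneg (by have := hε.le; positivity)]
        exact mul_le_mul_of_nonneg_right hkL (by have := hε.le; positivity)
      have hmBadb : ∀ k ≤ pruneLevel A (b + 1), ∀ (Y : Config k d (UnitAddTorus d)) (m : Fin k) (σ' : ℝ), 0 ≤ σ' →
          Y ∈ bgsrGoodConfigs (Literature.Analysis.FluidPDE.Torus.geometry d) k ε₀ σ' →
          ((sphereMeasure (E := EuclideanSpace ℝ d)).prod (volume : Measure (EuclideanSpace ℝ d)))
              {q : sphere (0 : EuclideanSpace ℝ d) 1 × EuclideanSpace ℝ d |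
                ‖q.2‖ ≤ E ∧ ((q.1 : EuclideanSpace ℝ d), q.2) ∈ bgsrBadSet (K * h) ā ε₀ δ (3 * E) Y m} ≤
            ENNReal.ofReal mBad := fun k hk => hmBad k (hk.trans hLb)
      have h := relStep_bgsrCouplingUpTo (d := d) hε hε' (N + 1) (α := α) (ε₀ := ε₀) (δ := δ) (t := K * h)
        (ā := ā) (E := E) hα0.le hδ hE hāε₀ (kmax := pruneLevel A (b + 1)) hkε hpfb hmBad0 hmBadb
        (half_pos hβ) hηb
      simp only [hΛrels, hErels, if_pos hb]
      exact h
    · simp only [hΛrels, hErels, if_neg hb]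
      exact relStep_bgsrCouplingUpTo_trivial (d := d) hε hε' (N + 1) α ε₀ (K * h) hδ.le (E ^ 2 / 2)
        (half_pos hβ) hηb (pruneLevel A (b + 1))
  -- the data
  set F0 : GCState d (UnitAddTorus d) := bgsrInitialMarginals hε hε' N β ρ₀ with hF0
  set G0 : GCState d (UnitAddTorus d) := fun a Z => bgsrHierarchyFamily β
    (linearBoltzmannSeries (Literature.Analysis.FluidPDE.Torus.geometry d) β α fun x _ => ρ₀ x) a 0 Z with hG0
  have hdat := linearBoltzmannData_torus (d := d) hβ hα0.le hρ₀c hρ₀0 hR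
  have hn₁ : ∀ k, IsNice (energyTruncate E F0 k) := fun k =>
    (isNice_bgsrInitialMarginals hβ hρ₀c.measurable hρ₀0 hR hN k).energyTruncate E
  have hn₂ : ∀ k, IsNice (energyTruncate E G0 k) := fun k =>
    (hdat.isNice_bgsrHierarchyFamily_zero k).energyTruncate E
  have hv₁ : ∀ (k : ℕ) (Z : Config k d (UnitAddTorus d)), E ^ 2 / 2 < configEnergy Z → energyTruncate E F0 k Z = 0 :=
    fun k Z hZ => energyTruncate_eq_zero_of_lt E F0 k Z hZ
  have hv₂ : ∀ (k : ℕ) (Z : Config k d (UnitAddTorus d)), E ^ 2 / 2 < configEnergy Z → energyTruncate E G0 k Z = 0 :=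
    fun k Z hZ => energyTruncate_eq_zero_of_lt E G0 k Z hZ
  have hC2 : max 1 (2 * maxwellianConst d β) ≤ C₀ := max_le_max le_rfl (by linarith)
  have hC1 : max 1 (maxwellianConst d β) ≤ C₀ := max_le_max le_rfl (by linarith)
  have hb₁ : IsLevelBdd (energyTruncate E F0) L R' C₀ β :=
    (((isLevelBdd_bgsrInitialMarginals hβ hρ₀0 hR hN L).mono le_rfl hR0 hRR'
      (le_trans zero_le_one (le_max_left _ _)) le_rfl).mono_const hR'0
      (le_trans zero_le_one (le_max_left _ _)) hC2).energyTruncate E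
  have hb₂ : IsLevelBdd (energyTruncate E G0) L R' C₀ β :=
    ((hdat.isLevelBdd_bgsrHierarchyFamily_zero L).mono_const hR'0
      (le_trans zero_le_one (le_max_left _ _)) hC1).energyTruncate E
  have hrel : 𝒞.IsRelLevelBddT (energyTruncate E F0) (energyTruncate E G0) L
      (2 * R * (N + 1) * (2 * ε) ^ Fintype.card d) C₀ β 0 :=
    isRelLevelBddT_bgsrInitialMarginals hβ hρ₀0 hR hN hLN E (K * h) ε₀ hδ.le
  have hηR0 : 0 ≤ 2 * R * (N + 1) * (2 * ε) ^ Fintype.card d := by have := hε.le; positivity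
  -- the budget
  have hbudget : β / 2 + ∑ b ∈ Finset.range K, βs b ≤ β := by
    have hsum : ∑ b ∈ Finset.range K, βs b = β / 4 * ∑ b ∈ Finset.range K, (1 / 2 : ℝ) ^ (K - b) := by
      rw [Finset.mul_sum]
      refine Finset.sum_congr rfl fun b _ => ?_
      show β / 4 / 2 ^ (K - b) = β / 4 * (1 / 2) ^ (K - b)
      rw [one_div, inv_pow, div_eq_mul_inv]
    rw [hsum]
    have h4 : 0 ≤ β / 4 := by positivity
    have := mul_le_mul_of_nonneg_left (HierarchyModel.sum_half_pow_le K) h4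
    linarith
  -- the top pair
  have hp : (z, z) ∈ 𝒞.rel 1 (K * h) :=
    (mem_bgsrCouplingUpTo_rel hε hε' (N + 1) α ε₀ hδ.le (K * h) 1 (K * h) _).2
      ⟨le_rfl, one_pos, mem_bgsrCoupledPairs_self hε hε' hδ.le hreg⟩
  -- the abstract comparison
  have hmain := 𝒞.abs_sepBlockComp_sub_sepBlockComp_le hδ.le hA1 (half_pos hβ) hC₀1 βs Λs θs Λrels Erels hβs0
    hθs0 hstep hV₁ hV₂ hΛ₁ hΛ₂ hΛr hEθ hh hK hR'0 hηR0 le_rfl hbudget hn₁ hn₂ hv₁ hv₂ hb₁ hb₂ hrel (z, z) hp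
    (by simp)
  refine hmain.trans ?_
  -- the sum of the per-collision errors
  have hsumθ : ∑ b ∈ Finset.range K, (pruneSeq A b : ℝ) * θs b ≤ 6 * (A : ℝ) ^ K * θ := by
    have h1 : ∑ b ∈ Finset.range K, (pruneSeq A b : ℝ) * θs b = θ * ∑ b ∈ Finset.range K, (A : ℝ) ^ (b + 1) := by
      rw [Finset.mul_sum]
      refine Finset.sum_congr rfl fun b hb => ?_
      rw [hθs]; dsimp only
      rw [if_pos (Finset.mem_range.1 hb), pruneSeq_apply]; push_cast; ring
    rw [h1]
    calc θ * ∑ b ∈ Finset.range K, (A : ℝ) ^ (b + 1) ≤ θ * (6 * (A : ℝ) ^ K) :=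
          mul_le_mul_of_nonneg_left (sum_pow_succ_le_six hA K) hθ0
      _ = 6 * (A : ℝ) ^ K * θ := by ring
  -- the product of the block factors
  have hprod : ∏ b ∈ Finset.range K, ∑ j ∈ Finset.range (pruneSeq A b), (C₀ * Λs b * h) ^ j / j ! ≤
      exp ((6 * M₂.pruneConst β + 12 * α) * C₀ * h * (A : ℝ) ^ K) := by
    have hblock : ∀ b ∈ Finset.range K, ∑ j ∈ Finset.range (pruneSeq A b), (C₀ * Λs b * h) ^ j / j ! ≤
        exp (C₀ * h * (M₂.pruneConst β * ((A : ℝ) ^ (b + 1) * sqrt 2 ^ (K - b)) + α * pruneLevel A (b + 1))) := by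
      intro b hb
      have hnb : (0 : ℝ) < pruneSeq A b := by exact_mod_cast one_le_pruneSeq hA1 b
      have hq : (1 : ℝ) ≤ sqrt 2 ^ (K - b) := one_le_pow₀ Real.one_lt_sqrt_two.le
      have hΛb : M₂.chainCost (β / 2) (β / 4 / 2 ^ (K - b) / pruneSeq A b) (pruneLevel A (b + 1)) ≤
          M₂.pruneConst β * pruneSeq A b * sqrt 2 ^ (K - b) := by
        refine M₂.chainCost_le hβ hq hnb (le_of_eq ?_) ?_
        · have hq2 : (sqrt 2 ^ (K - b)) ^ 2 = (2 : ℝ) ^ (K - b) := by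
            rw [← pow_mul, mul_comm (K - b) 2, pow_mul, sq_sqrt zero_le_two]
          rw [hq2]
          field_simp
        · have := pruneLevel_succ_le hA b
          have h' : ((pruneLevel A (b + 1) : ℕ) : ℝ) ≤ ((2 * A ^ (b + 1) : ℕ) : ℝ) := by exact_mod_cast this
          simpa [pruneSeq_apply] using h'
      have h0 : 0 ≤ C₀ * Λs b * h := by have := hΛs0 b; positivity
      refine (Real.sum_le_exp_of_nonneg h0 _).trans (exp_le_exp.2 ?_)
      rw [hΛs]; dsimp only
      have hcR := M₂.pruneConst_nonneg β
      calc C₀ * (M₂.chainCost (β / 2) (βs b / pruneSeq A b) (pruneLevel A (b + 1)) + α * pruneLevel A (b + 1)) * h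
          ≤ C₀ * (M₂.pruneConst β * pruneSeq A b * sqrt 2 ^ (K - b) + α * pruneLevel A (b + 1)) * h := by
            gcongr
        _ = C₀ * h * (M₂.pruneConst β * ((A : ℝ) ^ (b + 1) * sqrt 2 ^ (K - b)) + α * pruneLevel A (b + 1)) := by
            rw [pruneSeq_apply]; push_cast; ring
    calc ∏ b ∈ Finset.range K, ∑ j ∈ Finset.range (pruneSeq A b), (C₀ * Λs b * h) ^ j / j !
        ≤ ∏ b ∈ Finset.range K, exp (C₀ * h * (M₂.pruneConst β * ((A : ℝ) ^ (b + 1) * sqrt 2 ^ (K - b)) +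
            α * pruneLevel A (b + 1))) := by
          refine Finset.prod_le_prod (fun b _ => Finset.sum_nonneg fun j _ => ?_) hblock
          have := hΛs0 b; positivity
      _ = exp (∑ b ∈ Finset.range K, C₀ * h * (M₂.pruneConst β * ((A : ℝ) ^ (b + 1) * sqrt 2 ^ (K - b)) +
            α * pruneLevel A (b + 1))) := by rw [Real.exp_sum]
      _ ≤ exp ((6 * M₂.pruneConst β + 12 * α) * C₀ * h * (A : ℝ) ^ K) := by
          refine exp_le_exp.2 ?_
          have hs1 := sum_pow_mul_sqrt_two_pow_le hA K
          have hs2 := sum_pruneLevel_succ_le hA K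
          have hcR := M₂.pruneConst_nonneg β
          have e1 : ∑ b ∈ Finset.range K, C₀ * h * (M₂.pruneConst β * ((A : ℝ) ^ (b + 1) * sqrt 2 ^ (K - b)) +
              α * pruneLevel A (b + 1)) =
              ∑ b ∈ Finset.range K, (C₀ * h * M₂.pruneConst β * ((A : ℝ) ^ (b + 1) * sqrt 2 ^ (K - b)) +
                C₀ * h * α * (pruneLevel A (b + 1) : ℝ)) :=
            Finset.sum_congr rfl fun b _ => by ring
          rw [e1, Finset.sum_add_distrib, ← Finset.mul_sum, ← Finset.mul_sum]
          have e : (6 * M₂.pruneConst β + 12 * α) * C₀ * h * (A : ℝ) ^ K =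
              C₀ * h * M₂.pruneConst β * (6 * (A : ℝ) ^ K) + C₀ * h * α * (12 * (A : ℝ) ^ K) := by ring
          rw [e]
          have h1 : 0 ≤ C₀ * h * M₂.pruneConst β := by positivity
          have h2 : 0 ≤ C₀ * h * α := by positivity
          exact add_le_add (mul_le_mul_of_nonneg_left hs1 h1) (mul_le_mul_of_nonneg_left hs2 h2)
  -- assemble
  have hηsum : 2 * R * (N + 1) * (2 * ε) ^ Fintype.card d + R' * ∑ b ∈ Finset.range K, (pruneSeq A b : ℝ) * θs b ≤
      2 * R * (N + 1) * (2 * ε) ^ Fintype.card d + 6 * R' * (A : ℝ) ^ K * θ := by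
    have := mul_le_mul_of_nonneg_left hsumθ hR'0
    linarith
  have hP0 : 0 ≤ ∏ b ∈ Finset.range K, ∑ j ∈ Finset.range (pruneSeq A b), (C₀ * Λs b * h) ^ j / j ! :=
    Finset.prod_nonneg fun b _ => Finset.sum_nonneg fun j _ => by have := hΛs0 b; positivity
  have hS0 : 0 ≤ 2 * R * (N + 1) * (2 * ε) ^ Fintype.card d + 6 * R' * (A : ℝ) ^ K * θ := by positivity
  calc C₀ * ((2 * R * (N + 1) * (2 * ε) ^ Fintype.card d + R' * ∑ b ∈ Finset.range K, (pruneSeq A b : ℝ) * θs b) *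
        ∏ b ∈ Finset.range K, ∑ j ∈ Finset.range (pruneSeq A b), (C₀ * Λs b * h) ^ j / j !)
      ≤ C₀ * ((2 * R * (N + 1) * (2 * ε) ^ Fintype.card d + 6 * R' * (A : ℝ) ^ K * θ) *
          exp ((6 * M₂.pruneConst β + 12 * α) * C₀ * h * (A : ℝ) ^ K)) := by
        refine mul_le_mul_of_nonneg_left (mul_le_mul hηsum hprod hP0 hS0) hC₀0
    _ = _ := by ring

/-! ## Exchanging the BBGKY data for the honest initial marginals -/

omit [DecidableEq d] hαN in
/-- **The BBGKY data may be exchanged for the honest initial marginals, almost everywhere, at the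
price of the separation error** (under (R)): the time-`0` marginal family of
`HardSphereHierarchyModel` and `bgsrInitialMarginals` agree level by level almost everywhere
(`bgsrInitialMarginals_ae_eq`), so the plain block composite of the (energy-truncated) difference
vanishes a.e. (`blockComp_congr_ae`, hypothesis `RespectsAE`), and its separated block composite
is within N5d₃'s separation error `12 (2R) C' (C' c_R δ) A^{2K} exp(12 C' c_R h A^K)` of it
(`abs_blockComp_sub_sepBlockComp_le_of_budget`, the difference being level-bounded by
`2R C'^s e^{-βH}`, `C' = max 1 (2(β/2π)^{d/2})`). [cite: BodineauGallagherSaintRaymondInvent2016, §5.3.2 Prop. 5.5, pp. 19–20] -/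
theorem ae_abs_sepBlockComp_marginals_sub_initialMarginals_le
    (hRob : (hsHierarchyModel (d := d) hε hε' (N + 1)).RespectsAE (fun _ => volume))
    {A : ℕ} (hA : 2 ≤ A) (K : ℕ) {h δ : ℝ} (hδ : 0 ≤ δ) (hh0 : 0 ≤ h) (E : ℝ) :
    ∀ᵐ Z : Config 1 d (UnitAddTorus d),
      |(hsHierarchyModel (d := d) hε hε' (N + 1)).sepBlockComp δ (pruneSeq A) h K
            (energyTruncate E fun a => bgsrMarginalFamily (d := d) hε hε' N β ρ₀ a 0) 1 Z -
          (hsHierarchyModel (d := d) hε hε' (N + 1)).sepBlockComp δ (pruneSeq A) h K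
            (energyTruncate E (bgsrInitialMarginals hε hε' N β ρ₀)) 1 Z| ≤
        12 * (2 * R) * max 1 (2 * maxwellianConst d β) *
          (max 1 (2 * maxwellianConst d β) * (hsHierarchyModel (d := d) hε hε' (N + 1)).pruneConst β * δ) *
          (A : ℝ) ^ (2 * K) *
          exp (12 * (max 1 (2 * maxwellianConst d β) * (hsHierarchyModel (d := d) hε hε' (N + 1)).pruneConst β * h) *
            (A : ℝ) ^ K) := by
  set M₁ := hsHierarchyModel (d := d) hε hε' (N + 1) with hM₁
  set C' : ℝ := max 1 (2 * maxwellianConst d β) with hC'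
  set F0 : GCState d (UnitAddTorus d) := fun a => bgsrMarginalFamily (d := d) hε hε' N β ρ₀ a 0 with hF0
  set F0' : GCState d (UnitAddTorus d) := bgsrInitialMarginals hε hε' N β ρ₀ with hF0'
  set D : GCState d (UnitAddTorus d) := F0 - F0' with hD
  have hR0 : 0 ≤ R := (hρ₀0 0).trans (hR 0)
  have hC'1 : 1 ≤ C' := le_max_left _ _
  have hρ₀m : Measurable ρ₀ := hρ₀c.measurable
  have hnF : ∀ k, IsNice (F0 k) := fun k =>
    ⟨measurable_bgsrMarginalFamily hε hε' N β ρ₀ hρ₀m k 0, R * C' ^ k, β, hβ,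
      abs_bgsrMarginalFamily_le hε hε' N β ρ₀ hβ hρ₀0 hR hN k 0⟩
  have hnF' : ∀ k, IsNice (F0' k) := fun k => isNice_bgsrInitialMarginals hβ hρ₀m hρ₀0 hR hN k
  have hnD : ∀ k, IsNice (D k) := fun k => (hnF k).sub (hnF' k)
  have hnTF : ∀ k, IsNice (energyTruncate E F0 k) := fun k => (hnF k).energyTruncate E
  have hnTF' : ∀ k, IsNice (energyTruncate E F0' k) := fun k => (hnF' k).energyTruncate E
  have hnTD : ∀ k, IsNice (energyTruncate E D k) := fun k => (hnD k).energyTruncate E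
  -- the truncated difference
  have heT : energyTruncate E F0 - energyTruncate E F0' = energyTruncate E D := by
    funext k Z
    simp only [Pi.sub_apply, energyTruncate_apply, hD]
    split_ifs <;> simp
  have hsub : ∀ Z : Config 1 d (UnitAddTorus d),
      M₁.sepBlockComp δ (pruneSeq A) h K (energyTruncate E F0) 1 Z -
        M₁.sepBlockComp δ (pruneSeq A) h K (energyTruncate E F0') 1 Z =
      M₁.sepBlockComp δ (pruneSeq A) h K (energyTruncate E D) 1 Z := by
    intro Z
    have h := HierarchyModel.sepBlockComp_sub (M := M₁) hδ (pruneSeq A) hh0 K hnTF hnTF'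
    rw [heT] at h
    rw [h]; rfl
  -- the truncated difference is a.e. zero, level by level
  have hae : ∀ k, energyTruncate E D k =ᵐ[volume] (0 : GCState d (UnitAddTorus d)) k := by
    intro k
    filter_upwards [bgsrInitialMarginals_ae_eq (hε := hε) (hε' := hε') (N := N) (β := β) (ρ₀ := ρ₀) k] with Z hZ
    have hDZ : D k Z = 0 := by
      simp only [hD, Pi.sub_apply, hF0, hF0']
      rw [hZ, sub_self]
    simp only [energyTruncate_apply, hDZ, Pi.zero_apply, ite_self]
  -- hence its plain block composite vanishes a.e.
  have hzero : ∀ Z : Config 1 d (UnitAddTorus d), M₁.blockComp (pruneSeq A) h K (0 : GCState d (UnitAddTorus d)) 1 Z = 0 := by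
    intro Z
    have hA1 : 1 ≤ A := by omega
    have hlev : IsLevelBdd (0 : GCState d (UnitAddTorus d)) (pruneLevel A K) 0 1 (1 + K) := by
      intro a _ Z'; simp
    have h := M₁.abs_blockComp_le hA1 one_pos le_rfl (fun _ => (1 : ℝ)) (fun _ => one_pos) hh0 K 0 0 (1 + K)
      le_rfl (by simp) hlev Z
    simpa using h
  have hbc := HierarchyModel.blockComp_congr_ae (M := M₁) hRob (pruneSeq A) hh0 K hnTD
    (fun _ => IsNice.zero) hae 1
  -- the separation error of the truncated difference
  have hlevD : IsLevelBdd (energyTruncate E D) (pruneLevel A K) (2 * R) C' β := by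
    intro a _ Z
    refine (abs_energyTruncate_le E D a Z).trans ?_
    calc |D a Z| = |F0 a Z - F0' a Z| := rfl
      _ ≤ |F0 a Z| + |F0' a Z| := abs_sub _ _
      _ ≤ R * C' ^ a * exp (-β * configEnergy Z) + R * C' ^ a * exp (-β * configEnergy Z) :=
          add_le_add (abs_bgsrMarginalFamily_le hε hε' N β ρ₀ hβ hρ₀0 hR hN a 0 Z)
            (abs_bgsrInitialMarginals_le hβ hρ₀0 hR hN a Z)
      _ = 2 * R * C' ^ a * exp (-β * configEnergy Z) := by ring
  filter_upwards [hbc] with Z hZ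
  rw [hsub Z]
  have hsep := M₁.abs_blockComp_sub_sepBlockComp_le_of_budget hδ hA (by positivity : 0 ≤ 2 * R) hC'1 hβ hnTD K
    hlevD hh0 Z
  have h0 : M₁.blockComp (pruneSeq A) h K (energyTruncate E D) 1 Z = 0 := by
    rw [hZ]; exact hzero Z
  calc |M₁.sepBlockComp δ (pruneSeq A) h K (energyTruncate E D) 1 Z|
      = |M₁.blockComp (pruneSeq A) h K (energyTruncate E D) 1 Z -
          M₁.sepBlockComp δ (pruneSeq A) h K (energyTruncate E D) 1 Z| := by rw [h0, zero_sub, abs_neg]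
    _ ≤ _ := hsep

/-! ## The tagged distribution and the Boltzmann solution at time `Kh`, under (S), (R), regularity -/

/-- **BGSR Props. 4.3, 5.3–5.7 assembled: the tagged distribution and the Boltzmann solution
differ, at time `Kh` and almost everywhere, by explicit pruning, truncation, separation,
data, prefactor and bad-set errors.** Setting of `abs_sepBlockComp_hs_sub_boltzmann_le`, plus
the step condition `C' c_R h ≤ γ/e²` of Prop. 4.3 (`0 ≤ γ ≤ 1/2`), `Kh ≤ T`, and the three
inputs on the hard-sphere dynamics: (S) the iterated Duhamel formula up to null sets for the
marginals on `[0, T]` and (R) the Duhamel terms of the hard-sphere model respect null sets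
(the hypotheses of `bgsrMarginal_ae_abs_sub_truncSepMain_le`, `HardSphereHierarchyModel`), and
(Reg) almost every one-particle configuration is regular to all depths for the horizon `Kh`
(`bgsrRegular`, `PseudoTrajectoryCoupling`). Then for a.e. `Z : Config 1`,
`|f_N^{(1)}(Kh)(Z) - (φ_α(Kh) M_β)(Z)|` is at most the sum of: the BBGKY-side reduction error
(`bgsrMarginal_ae_abs_sub_truncSepMain_le`), the data-exchange error
(`ae_abs_sepBlockComp_marginals_sub_initialMarginals_le`), the comparison of the main terms
(`abs_sepBlockComp_hs_sub_boltzmann_le`) and the Boltzmann-side reduction error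
(`abs_bgsrHierarchyFamily_sub_truncSepMain_le_torus`). Printed: Prop. 5.8 before tuning,
p. 21, first display of the proof. [cite: BodineauGallagherSaintRaymondInvent2016, §5.3.4 Prop. 5.8 proof, p. 21] -/
theorem ae_abs_bgsrMarginalFamily_sub_bgsrHierarchyFamily_le {T : ℝ}
    (hS : ∀ s ≤ N + 1, ∀ t ∈ Icc 0 T,
      (hsHierarchyModel (d := d) hε hε' (N + 1)).seriesFamily (N + 1)
          (fun k => bgsrMarginalFamily hε hε' N β ρ₀ k 0) s t =ᵐ[volume]
        bgsrMarginalFamily hε hε' N β ρ₀ s t)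
    (hRob : (hsHierarchyModel (d := d) hε hε' (N + 1)).RespectsAE (fun _ => volume))
    {A : ℕ} (hA : 2 ≤ A) {K : ℕ} (hK : 1 ≤ K) {h δ : ℝ} (hδ : 0 < δ) (hh : δ ≤ h) (hKT : K * h ≤ T)
    {γ : ℝ} (hγ0 : 0 ≤ γ) (hγ : γ ≤ 1 / 2)
    (hsmall : max 1 (2 * maxwellianConst d β) * (hsHierarchyModel (d := d) hε hε' (N + 1)).pruneConst β * h ≤
      γ / exp 2)
    {E : ℝ} (hE : 0 ≤ E) {ā ε₀ : ℝ} (hāε₀ : 4 * ā ≤ ε₀)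
    (hLε : (pruneLevel A K + 1 : ℝ) * ε ≤ ā) (hLN : pruneLevel A K ≤ N + 1) {mBad : ℝ} (hmBad0 : 0 ≤ mBad)
    (hmBad : ∀ k ≤ pruneLevel A K, ∀ (Y : Config k d (UnitAddTorus d)) (m : Fin k) (σ' : ℝ), 0 ≤ σ' →
      Y ∈ bgsrGoodConfigs (Literature.Analysis.FluidPDE.Torus.geometry d) k ε₀ σ' →
      ((sphereMeasure (E := EuclideanSpace ℝ d)).prod (volume : Measure (EuclideanSpace ℝ d)))
          {q : sphere (0 : EuclideanSpace ℝ d) 1 × EuclideanSpace ℝ d |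
            ‖q.2‖ ≤ E ∧ ((q.1 : EuclideanSpace ℝ d), q.2) ∈ bgsrBadSet (K * h) ā ε₀ δ (3 * E) Y m} ≤
        ENNReal.ofReal mBad)
    (hreg : ∀ᵐ z : Config 1 d (UnitAddTorus d), ∀ n, bgsrRegular ε n 1 (K * h) z) :
    ∀ᵐ Z : Config 1 d (UnitAddTorus d),
      |bgsrMarginalFamily (d := d) hε hε' N β ρ₀ 1 (K * h) Z -
          bgsrHierarchyFamily β
            (linearBoltzmannSeries (Literature.Analysis.FluidPDE.Torus.geometry d) β α fun x _ => ρ₀ x) 1 (K * h) Z| ≤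
        (4 * γ ^ A * R * max 1 (2 * maxwellianConst d β) +
          R * exp (-(β * E ^ 2 / 4)) * max 1 (2 * maxwellianConst d β) *
            exp (6 * (max 1 (2 * maxwellianConst d β) *
              (hsHierarchyModel (d := d) hε hε' (N + 1)).pruneConst (β / 2) * h) * (A : ℝ) ^ K) +
          12 * R * max 1 (2 * maxwellianConst d β) *
            (max 1 (2 * maxwellianConst d β) * (hsHierarchyModel (d := d) hε hε' (N + 1)).pruneConst β * δ) *
            (A : ℝ) ^ (2 * K) *
            exp (12 * (max 1 (2 * maxwellianConst d β) *
              (hsHierarchyModel (d := d) hε hε' (N + 1)).pruneConst β * h) * (A : ℝ) ^ K)) +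
        12 * (2 * R) * max 1 (2 * maxwellianConst d β) *
          (max 1 (2 * maxwellianConst d β) * (hsHierarchyModel (d := d) hε hε' (N + 1)).pruneConst β * δ) *
          (A : ℝ) ^ (2 * K) *
          exp (12 * (max 1 (2 * maxwellianConst d β) * (hsHierarchyModel (d := d) hε hε' (N + 1)).pruneConst β * h) *
            (A : ℝ) ^ K) +
        max 1 (4 * maxwellianConst d β) *
          (2 * R * (N + 1) * (2 * ε) ^ Fintype.card d +
            6 * max R 1 * (A : ℝ) ^ K * (pruneLevel A K * ε ^ (Fintype.card d - 1) / α + 4 * E * mBad)) *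
          exp ((6 * (boltzmannModel (Literature.Analysis.FluidPDE.Torus.geometry d) measurable_translate_torus α).pruneConst β +
            12 * α) * max 1 (4 * maxwellianConst d β) * h * (A : ℝ) ^ K) +
        (2 * γ ^ A * max R 1 * max 1 (maxwellianConst d β) +
          max R 1 * exp (-(β * E ^ 2 / 4)) * max 1 (maxwellianConst d β) *
            exp (6 * (max 1 (maxwellianConst d β) *
              (boltzmannModel (Literature.Analysis.FluidPDE.Torus.geometry d) measurable_translate_torus α).pruneConst
                (β / 2) * h) * (A : ℝ) ^ K) +
          12 * max R 1 * max 1 (maxwellianConst d β) *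
            (max 1 (maxwellianConst d β) *
              (boltzmannModel (Literature.Analysis.FluidPDE.Torus.geometry d) measurable_translate_torus α).pruneConst β * δ) *
            (A : ℝ) ^ (2 * K) *
            exp (12 * (max 1 (maxwellianConst d β) *
              (boltzmannModel (Literature.Analysis.FluidPDE.Torus.geometry d) measurable_translate_torus α).pruneConst β * h) *
              (A : ℝ) ^ K)) := by
  set M₁ := hsHierarchyModel (d := d) hε hε' (N + 1) with hM₁
  set M₂ := boltzmannModel (Literature.Analysis.FluidPDE.Torus.geometry d) measurable_translate_torus α with hM₂
  have hρ₀m : Measurable ρ₀ := hρ₀c.measurable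
  have hα0 : 0 ≤ α := by rw [hαN]; have := hε.le; positivity
  have hmc : 0 < maxwellianConst d β := maxwellianConst_pos hβ
  -- the pruning constants of the two models agree
  have hopc : M₁.opConst = M₂.opConst := by
    show (((N + 1 : ℕ) : ℝ) * ε ^ (Fintype.card d - 1)) *
        ((∫ u : EuclideanSpace ℝ d, (1 + ‖u‖) * exp (-(1 / 2) * ‖u‖ ^ 2)) *
          (sphereMeasure (E := EuclideanSpace ℝ d)).real univ) =
      |α| * ((∫ u : EuclideanSpace ℝ d, (1 + ‖u‖) * exp (-(1 / 2) * ‖u‖ ^ 2)) *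
          (sphereMeasure (E := EuclideanSpace ℝ d)).real univ)
    rw [hαN, abs_of_nonneg (by have := hε.le; positivity)]
    push_cast; ring
  have hpc : ∀ b', M₂.pruneConst b' = M₁.pruneConst b' := fun b' => by
    simp only [HierarchyModel.pruneConst, hopc]
  have hsmall₂ : max 1 (maxwellianConst d β) * M₂.pruneConst β * h ≤ γ / exp 2 := by
    refine le_trans ?_ hsmall
    rw [hpc]
    have h1 : max 1 (maxwellianConst d β) ≤ max 1 (2 * maxwellianConst d β) := max_le_max le_rfl (by linarith)
    have := M₁.pruneConst_nonneg β
    have hh0 : 0 ≤ h := hδ.le.trans hh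
    exact mul_le_mul_of_nonneg_right (mul_le_mul_of_nonneg_right h1 this) hh0
  have h1 := bgsrMarginal_ae_abs_sub_truncSepMain_le hε hε' N β ρ₀ hβ hρ₀m hρ₀0 hR hN hS hRob hA hγ0 hγ
    (hδ.le.trans hh) hsmall K hKT E hδ.le
  have h2 := ae_abs_sepBlockComp_marginals_sub_initialMarginals_le hε hε' N hβ hρ₀c hρ₀0 hR hN hRob hA K
    hδ.le (hδ.le.trans hh) E
  filter_upwards [h1, h2, hreg] with Z hZ1 hZ2 hZreg
  have h3 := abs_sepBlockComp_hs_sub_boltzmann_le hε hε' N hβ hρ₀c hρ₀0 hR hN hαN hA hK hδ hh hE hāε₀ hLε hLN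
    hmBad0 hmBad hZreg
  have h4 := abs_bgsrHierarchyFamily_sub_truncSepMain_le_torus (d := d) hβ hα0 hρ₀c hρ₀0 hR hA hγ0 hγ
    (hδ.le.trans hh) hsmall₂ E hδ.le K Z
  -- chain the four estimates
  have key := abs_sub_le_of_four hZ1 hZ2 h3 h4
  exact key


end MainTerms

end Kinetic

end

end Literature.MathematicalPhysics.KineticTheory
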